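import Summits.ABC.IUTFork.Thm311RealInd2Ism
import Literature.IUT.HodgeArakelov.AbsTopMonoidsGenuineZhatNaturality
import HarnessLib

/-!
# [IUTchIII] Theorem 3.11 (i) (Ind1) at `v ∈ 𝕍^non`, PRINT-LITERAL: the STRIP PART — automorphisms of the
# `𝒟⊢`-prime-strip at `v` (= topological automorphisms of `G_v`) acting on the real log-shell `K_v ⊇ I_v` through
# THE equivariant lift to `O^⊳(G_v) = 𝒪^⊳_{K̄_v}`

Record file (D-0012) of the abc-iut cell (Cor. 3.12 sub-crew, seat abc-iut-c312-1 = holder of record of the typed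
[IUTchIII] Thm. 3.11, gen 8); TAKES NO SIDE on [IUTchIII] Cor. 3.12.

THE BINDER IT REPLACES.  abc-iut-c312-5's real signature `Real.logShells X logv Aut Ism …` leaves the (Ind1) strip slot
`Aut` a BINDER («`stripAut` (induced by isomorphisms of `D⊢`-prime-strips, i.e. of the topological group `G_v`, Prop. 1.2
(vi) functoriality / [AbsTopIII] Prop. 5.8 (ii))»); its Dupuy–Hilado instance is `Real.stripAutDH = {1}` (DH §4.7: (Ind1) =
the capsule-index permutations only).  Print, [IUTchIII] Thm. 3.11 (i) (kurims p. 154 l. 52–54, cell render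
`IUTchIII-kurims-url-4b091feeb646`): "(Ind1) the indeterminacies induced by the automorphisms of the procession of
`𝒟⊢`-prime-strips `Prc(ⁿ’°𝒟⊢_T)`"; an automorphism of a procession is, at each capsule member and each `v ∈ 𝕍`, an
isomorphism of the `𝒟⊢`-prime-strip data `†𝒟⊢_v` ([IUTchI] Def. 4.1 (iii): at `v ∈ 𝕍^non` a category `≅ ℬ(G_v)⁰`), i.e.
an (outer) isomorphism of the topological group `G_v`; it acts on `log(†𝒟⊢_v) = {G_v ↷ k~(G_v)} ⊇ ℐ(G_v)` by the
functoriality of the mono-analytic algorithm ([IUTchIII] Prop. 1.2 (vi) «functorial algorithm in the category `†𝒟⊢_v`»;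
[AbsTopIII] Prop. 5.8 (ii); Prop. 3.2 (iv) «`Π ↦ (Π ↷ M)` functorial in open injections/isomorphisms»).

TYPED (every constant a landed tree decl; no `Prop` fact): for `φ : Gal v ≃ₜ* Gal v` (a topological automorphism of
`G_v = Gal(K̄_v/K_v)`, the `Π` of abc-iut-L4-t2's model `TM`-pair at `closureAt v`):
* `Real.stripLift v φ` — THE `φ`-equivariant automorphism of `O^×(G_v) = (𝒪^⊳_{K̄_v})ˣ` (units of abc-iut-L6-t13's
  `Genuine.liftM (closureAt v) φ`, [AbsTopIII] Prop. 3.2 (iv): unique by `Genuine.liftM_unique`);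
* `Real.stripMulAut v φ ∈ Aut(O^{×μ}(G_v))` — the induced automorphism of `O^{×μ} = O^×⧸μ` (the object on which print's
  (Ind2) isometries `Real.ismGenuine v` also act, `Thm311RealInd2Ism`);
* `Real.liftUnits v φ : 𝒪_v^× ≃* 𝒪_v^×` — its restriction to the `G_v`-invariants `O^×(G_v)^{G_v} = 𝒪_v^×`
  (`Real.mem_fixedBy_top_iff`), i.e. the action of `φ` on `K_v`'s own units;
* **`Real.ind1StripOf v L`** — PRINT'S (Ind1) STRIP PART AT `v` on the real log-shell: the bicontinuous additive
  automorphisms `ψ` of `K_v` REALISING `stripMulAut v φ` through the logarithm `L` for some `φ` (`Real.Realises`, the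
  same passage `O^{×μ}(G_v) ⊇ O^{×μ}(G_v)^{G_v} = 𝒪_v^×⧸μ —log→ I_v ⊆ K_v` as for (Ind2)).

PROVED: `Real.stripLift_toOUnits` / `Real.stripMulAut_clsOf` (the lift maps the class of `u ∈ 𝒪_v^×` to the class of
`liftUnits v φ u`); `Real.realises_stripMulAut_iff` (`ψ` realises `φ` iff `ψ (L u) = L (liftUnits v φ u)` for all `u`);
`Real.refl_mem_ind1StripOf`; **`Real.image_shell_eq_of_mem_ind1StripOf`** (`ψ(I_v) = I_v` — so print's (Ind1) strip
part, like print's (Ind2), ACTS THROUGH Dupuy–Hilado's `Aut_{ℚ_p}(K_v : I_v)`; sequel `Thm311RealInd1StripSignature`);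
§4 INNER AUTOMORPHISMS ACT TRIVIALLY: `Real.stripLift_innerAut` (THE lift of `conj(σ)` is `σ` itself),
`Real.liftUnits_innerAut` (`= 1` on `𝒪_v^×`), **`Real.realises_innerAut_iff`** (a `ψ` realises an inner automorphism iff
it fixes `L(𝒪_v^×)` pointwise) — the action factors through `Out(G_v)`, as print's "isomorphisms of `†𝒟⊢_v`"
(isomorphism classes of equivalences `ℬ(G_v)⁰ ⥲ ℬ(G_v)⁰` = outer isomorphisms) requires.

HONEST SCOPE: a statement about OUR typed objects at ONE place `v` and ONE strip; the capsule-index permutations of (Ind1)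
are abc-iut-c312-1's `LogShells.Ind1` (unchanged); the compatibility of a procession automorphism ACROSS `v ∈ 𝕍` and
across capsule members is not constrained here (print lets independent isomorphisms act at each `(i, v)`, cf.
`LogShells.Ind1`); the archimedean strip part is untouched; Mochizuki's "ind-topological" is rendered by bicontinuity of
`ψ`; nothing here asserts or refutes [IUTchIII] Cor. 3.12.  [claim: Mochizuki2012, status: disputed] for every
quotation; [cite: MochizukiAbsTopIII2015, Proposition 3.2 (iv) p.72]; [cite: DupuyHilado2025, §4.7]. typed ≠ proved.
-/

set_option autoImplicit false

noncomputable section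

namespace Summit.ABC.IUTFork.Thm311.Real

open NumberField IsDedekindDomain Literature.IUT.LogVolume Literature.IUT.LogThetaLattice
open Literature.AnabelianGeometry.AbsoluteAnabelian Literature.IUT.HodgeArakelov
open Literature.IUT.HodgeArakelov.AbsTopMonoids

variable {F : Type} [Field F] [NumberField F] (v : HeightOneSpectrum (𝓞 F))

/-! ## 1. Automorphisms of `†𝒟⊢_v` and THE lift to `O^×(G_v)`, `O^{×μ}(G_v)` -/

/-- **THE lift of `φ ∈ Aut_top(G_v)` to `O^×(G_v) = (𝒪^⊳_{K̄_v})ˣ`**: the units of abc-iut-L6-t13's `Genuine.liftM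
(closureAt v) φ`, THE `φ`-equivariant monoid automorphism of `𝒪^⊳_{K̄_v}` ([AbsTopIII] Prop. 3.2 (iv); unique,
`Genuine.liftM_unique`) — the functoriality by which an isomorphism of `𝒟⊢`-prime-strips at `v` acts on the
mono-analytic data ([IUTchIII] Prop. 1.2 (vi)). [cite: MochizukiAbsTopIII2015, Proposition 3.2 (iv) p.72] -/
def stripLift (φ : Gal v ≃ₜ* Gal v) : OUnits v ≃* OUnits v :=
  Units.mapEquiv (Genuine.liftM (closureAt v) φ)

/-- Underlying element: `stripLift v φ x = liftM φ x` in `K̄_v`. [cite: MochizukiAbsTopIII2015, Proposition 3.2 (iv) p.72] -/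
theorem coe_stripLift (φ : Gal v ≃ₜ* Gal v) (x : OUnits v) :
    (((stripLift v φ x : OUnits v) :
        nonzeroIntegers (v.adicCompletion F) (AlgebraicClosure (v.adicCompletion F))) :
      AlgebraicClosure (v.adicCompletion F)) =
      ((Genuine.liftM (closureAt v) φ
          (x : nonzeroIntegers (v.adicCompletion F) (AlgebraicClosure (v.adicCompletion F))) :
        nonzeroIntegers (v.adicCompletion F) (AlgebraicClosure (v.adicCompletion F))) :
        AlgebraicClosure (v.adicCompletion F)) := by
  rw [stripLift, Units.coe_mapEquiv]

/-- **The automorphism of `O^{×μ}(G_v) = O^×(G_v)⧸μ` induced by `φ`** — the (Ind1) strip automorphism read on the same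
object as print's (Ind2) isometries (`Real.ismGenuine v ⊆ Aut(O^{×μ}(G_v))`).
[claim: Mochizuki2012, status: disputed] -/
def stripMulAut (φ : Gal v ≃ₜ* Gal v) : MulAut (ModTorsion (OUnits v)) :=
  MulEquivModTorsion (stripLift v φ)

/-- `stripMulAut v φ [x] = [stripLift v φ x]`. [folklore] -/
theorem stripMulAut_mk (φ : Gal v ≃ₜ* Gal v) (x : OUnits v) :
    stripMulAut v φ (QuotientGroup.mk x) = QuotientGroup.mk (stripLift v φ x) :=
  mulEquivModTorsion_mk _ _

/-- The lift of a composite is the composite of the lifts (`Genuine.liftM_trans`). [cite: MochizukiAbsTopIII2015, Proposition 3.2 (iv) p.72] -/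
theorem stripLift_trans (φ₁ φ₂ : Gal v ≃ₜ* Gal v) (x : OUnits v) :
    stripLift v (φ₁.trans φ₂) x = stripLift v φ₂ (stripLift v φ₁ x) := by
  apply Units.ext
  rw [stripLift, stripLift, stripLift, Units.coe_mapEquiv, Units.coe_mapEquiv, Units.coe_mapEquiv]
  exact DFunLike.congr_fun
    (Genuine.liftM_trans (closureAt v) (φ₁ := φ₁) (φ₂ := φ₂) (φ := φ₁.trans φ₂) (fun _ => rfl)) _

/-- The lift of the identity is the identity (`Genuine.liftM_refl`). [cite: MochizukiAbsTopIII2015, Proposition 3.2 (iv) p.72] -/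
theorem stripLift_refl (x : OUnits v) : stripLift v (ContinuousMulEquiv.refl (Gal v)) x = x := by
  apply Units.ext
  rw [stripLift, Units.coe_mapEquiv, Genuine.liftM_refl (closureAt v) (fun _ => rfl)]
  rfl

/-- `stripLift v φ.symm` inverts `stripLift v φ`. [folklore] -/
theorem stripLift_symm_apply (φ : Gal v ≃ₜ* Gal v) (x : OUnits v) :
    stripLift v φ.symm (stripLift v φ x) = x := by
  rw [← stripLift_trans]
  apply Units.ext
  rw [stripLift, Units.coe_mapEquiv, Genuine.liftM_refl (closureAt v) (fun σ => φ.symm_apply_apply σ)]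
  rfl

/-! ## 2. The action on the `G_v`-invariants `O^×(G_v)^{G_v} = 𝒪_v^×`: `liftUnits` -/

/-- **THE lift carries `G_v`-fixed units to `G_v`-fixed units** (`φ`-equivariance: `liftM (σ • x) = φ σ • liftM x`,
abc-iut-L6-d2's `Genuine.liftM_fixed_of_fixed` at `H = G_v`, `φ(G_v) = G_v`). [cite: MochizukiAbsTopIII2015, Proposition 3.2 (iv) p.72] -/
theorem stripLift_mem_fixedBy_top (φ : Gal v ≃ₜ* Gal v) {x : OUnits v} (hx : x ∈ fixedBy (galRho v) ⊤) :
    stripLift v φ x ∈ fixedBy (galRho v) ⊤ := by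
  rw [mem_fixedBy] at hx ⊢
  intro σ _
  apply Units.ext; apply Subtype.ext
  rw [coe_galRho, coe_stripLift]
  refine Genuine.liftM_fixed_of_fixed (closureAt v) φ ⊤ _ (fun τ _ => ?_) σ ?_
  · have h := congrArg (fun y : OUnits v =>
      ((y : nonzeroIntegers (v.adicCompletion F) (AlgebraicClosure (v.adicCompletion F))) :
        AlgebraicClosure (v.adicCompletion F))) (hx τ (Subgroup.mem_top τ))
    simp only [coe_galRho] at h
    exact h
  · exact Subgroup.mem_map.mpr ⟨φ.symm σ, Subgroup.mem_top _, φ.apply_symm_apply σ⟩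

/-- For `u ∈ 𝒪_v^×` there is a unique `u' ∈ 𝒪_v^×` with `stripLift v φ (u) = u'` inside `O^×(G_v)`
(`O^×(G_v)^{G_v} = 𝒪_v^×`, `Real.mem_fixedBy_top_iff`). [cite: MochizukiAbsTopIII2015, Definition 3.1 (iv) p.69] -/
theorem existsUnique_stripLift_toOUnits (φ : Gal v ≃ₜ* Gal v) (u : (↥(v.adicCompletionIntegers F))ˣ) :
    ∃! u' : (↥(v.adicCompletionIntegers F))ˣ, stripLift v φ (toOUnits v u) = toOUnits v u' := by
  obtain ⟨u', hu'⟩ := (mem_fixedBy_top_iff v _).mp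
    (stripLift_mem_fixedBy_top v φ (toOUnits_mem_fixedBy_top v u))
  exact ⟨u', hu', fun u'' hu'' => toOUnits_injective v (hu''.symm.trans hu')⟩

/-- The function `u ↦ u'` of `existsUnique_stripLift_toOUnits`. [folklore] -/
def liftUnitsFun (φ : Gal v ≃ₜ* Gal v) (u : (↥(v.adicCompletionIntegers F))ˣ) : (↥(v.adicCompletionIntegers F))ˣ :=
  (existsUnique_stripLift_toOUnits v φ u).exists.choose

/-- Defining property: `stripLift v φ (u) = liftUnitsFun v φ u` in `O^×(G_v)`. [folklore] -/
theorem stripLift_toOUnits' (φ : Gal v ≃ₜ* Gal v) (u : (↥(v.adicCompletionIntegers F))ˣ) :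
    stripLift v φ (toOUnits v u) = toOUnits v (liftUnitsFun v φ u) :=
  (existsUnique_stripLift_toOUnits v φ u).exists.choose_spec

/-- Characterisation: `liftUnitsFun v φ u = u'` iff `stripLift v φ (u) = u'`. [folklore] -/
theorem liftUnitsFun_eq_iff (φ : Gal v ≃ₜ* Gal v) (u u' : (↥(v.adicCompletionIntegers F))ˣ) :
    liftUnitsFun v φ u = u' ↔ stripLift v φ (toOUnits v u) = toOUnits v u' := by
  constructor
  · rintro rfl; exact stripLift_toOUnits' v φ u
  · intro h; exact toOUnits_injective v ((stripLift_toOUnits' v φ u).symm.trans h)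

/-- `liftUnitsFun` is multiplicative. [folklore] -/
theorem liftUnitsFun_mul (φ : Gal v ≃ₜ* Gal v) (a b : (↥(v.adicCompletionIntegers F))ˣ) :
    liftUnitsFun v φ (a * b) = liftUnitsFun v φ a * liftUnitsFun v φ b := by
  rw [liftUnitsFun_eq_iff, map_mul, map_mul, stripLift_toOUnits', stripLift_toOUnits', map_mul]

/-- `liftUnitsFun v φ.symm` inverts `liftUnitsFun v φ`. [folklore] -/
theorem liftUnitsFun_symm_apply (φ : Gal v ≃ₜ* Gal v) (u : (↥(v.adicCompletionIntegers F))ˣ) :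
    liftUnitsFun v φ.symm (liftUnitsFun v φ u) = u := by
  rw [liftUnitsFun_eq_iff, ← stripLift_toOUnits', stripLift_symm_apply]

/-- **The action of `φ ∈ Aut_top(G_v)` on `𝒪_v^× = O^×(G_v)^{G_v}`**: the restriction of THE lift `stripLift v φ` to the
`G_v`-invariant units, as a group automorphism of `𝒪_v^×` (inverse: the restriction of the lift of `φ⁻¹`).
[claim: Mochizuki2012, status: disputed] -/
def liftUnits (φ : Gal v ≃ₜ* Gal v) : (↥(v.adicCompletionIntegers F))ˣ ≃* (↥(v.adicCompletionIntegers F))ˣ where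
  toFun := liftUnitsFun v φ
  invFun := liftUnitsFun v φ.symm
  left_inv u := liftUnitsFun_symm_apply v φ u
  right_inv u := by
    have h := liftUnitsFun_symm_apply v φ.symm u
    rwa [ContinuousMulEquiv.symm_symm] at h
  map_mul' := liftUnitsFun_mul v φ

/-- `liftUnits v φ u = liftUnitsFun v φ u`. [folklore] -/
@[simp] theorem liftUnits_apply (φ : Gal v ≃ₜ* Gal v) (u : (↥(v.adicCompletionIntegers F))ˣ) :
    liftUnits v φ u = liftUnitsFun v φ u := rfl

/-- **`stripLift v φ (u) = liftUnits v φ u`** in `O^×(G_v)`, for `u ∈ 𝒪_v^×`. [claim: Mochizuki2012, status: disputed] -/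
theorem stripLift_toOUnits (φ : Gal v ≃ₜ* Gal v) (u : (↥(v.adicCompletionIntegers F))ˣ) :
    stripLift v φ (toOUnits v u) = toOUnits v (liftUnits v φ u) :=
  stripLift_toOUnits' v φ u

/-- **`stripMulAut v φ [u] = [liftUnits v φ u]`** in `O^{×μ}(G_v)`, for `u ∈ 𝒪_v^×`. [claim: Mochizuki2012, status: disputed] -/
theorem stripMulAut_clsOf (φ : Gal v ≃ₜ* Gal v) (u : (↥(v.adicCompletionIntegers F))ˣ) :
    stripMulAut v φ (clsOf v u) = clsOf v (liftUnits v φ u) := by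
  rw [clsOf_eq_mk, clsOf_eq_mk, stripMulAut_mk, stripLift_toOUnits]

/-- `liftUnits` of the identity automorphism is the identity of `𝒪_v^×`. [folklore] -/
theorem liftUnits_refl (u : (↥(v.adicCompletionIntegers F))ˣ) :
    liftUnits v (ContinuousMulEquiv.refl (Gal v)) u = u := by
  rw [liftUnits_apply, liftUnitsFun_eq_iff, stripLift_refl]

/-- `liftUnits` is compatible with composition. [folklore] -/
theorem liftUnits_trans (φ₁ φ₂ : Gal v ≃ₜ* Gal v) (u : (↥(v.adicCompletionIntegers F))ˣ) :
    liftUnits v (φ₁.trans φ₂) u = liftUnits v φ₂ (liftUnits v φ₁ u) := by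
  rw [liftUnits_apply, liftUnitsFun_eq_iff, stripLift_trans, stripLift_toOUnits, stripLift_toOUnits]

/-! ## 3. Realisation on `K_v`: print's (Ind1) strip part at `v` -/

section Realisation

variable (L : Additive (↥(v.adicCompletionIntegers F))ˣ →+ v.adicCompletion F)

/-- **`ψ` realises the strip automorphism `φ` through `L` iff `ψ (L u) = L (liftUnits v φ u)` for every `u ∈ 𝒪_v^×`**
(`Real.Realises` of `Thm311RealInd2Ism`, unfolded for `stripMulAut v φ`: `L` is constant on torsion classes).
[claim: Mochizuki2012, status: disputed] -/
theorem realises_stripMulAut_iff (φ : Gal v ≃ₜ* Gal v) (ψ : v.adicCompletion F ≃+ v.adicCompletion F) :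
    Realises v L (stripMulAut v φ) ψ ↔
      ∀ u : (↥(v.adicCompletionIntegers F))ˣ, ψ (L (Additive.ofMul u)) = L (Additive.ofMul (liftUnits v φ u)) := by
  constructor
  · intro h u
    exact h u (liftUnits v φ u) (stripMulAut_clsOf v φ u)
  · intro h u u' huu'
    rw [stripMulAut_clsOf] at huu'
    rw [h u]
    exact log_eq_of_clsOf_eq v L huu'

/-- **PRINT'S (Ind1) STRIP PART AT THE FINITE PLACE `v`**, over a logarithm `L` ([IUTchIII] Thm. 3.11 (i) (Ind1), p. 154
l. 52–54, read at one `v ∈ 𝕍^non` and one strip: "the indeterminacies induced by the automorphisms of the procession of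
`𝒟⊢`-prime-strips" — at `v`, automorphisms `φ` of `†𝒟⊢_v ≅ ℬ(G_v)⁰`, i.e. of the topological group `G_v`, acting on
`log(†𝒟⊢_v) ⊇ ℐ_{†𝒟⊢_v}` by functoriality, Prop. 1.2 (vi) / [AbsTopIII] Prop. 5.8 (ii)): the bicontinuous additive
automorphisms of `K_v` INDUCED, through `L` on `O^{×μ}(G_v)^{G_v} = 𝒪_v^×⧸μ`, by THE lift of some `φ ∈ Aut_top(G_v)` to
`O^{×μ}(G_v)`. [claim: Mochizuki2012, status: disputed] -/
def ind1StripOf : Set (v.adicCompletion F ≃+ v.adicCompletion F) :=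
  {ψ | Continuous ψ ∧ Continuous ψ.symm ∧ ∃ φ : Gal v ≃ₜ* Gal v, Realises v L (stripMulAut v φ) ψ}

/-- The identity realises the identity strip automorphism. [folklore] -/
theorem realises_stripMulAut_refl :
    Realises v L (stripMulAut v (ContinuousMulEquiv.refl (Gal v))) (AddEquiv.refl _) := by
  rw [realises_stripMulAut_iff]
  intro u
  rw [liftUnits_refl]
  rfl

/-- `1 ∈` print's (Ind1) strip part. [folklore] -/
theorem refl_mem_ind1StripOf : AddEquiv.refl (v.adicCompletion F) ∈ ind1StripOf v L :=
  ⟨continuous_id, continuous_id, ContinuousMulEquiv.refl _, realises_stripMulAut_refl v L⟩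

/-- A realised strip automorphism maps the log-shell `I_v = (p^*)⁻¹·L(𝒪_v^×)` INTO itself
(`ψ((p^*)⁻¹ L u) = (p^*)⁻¹ L (liftUnits v φ u)`). [claim: Mochizuki2012, status: disputed] -/
theorem image_shell_subset_of_realises_strip (p : ℕ) {φ : Gal v ≃ₜ* Gal v}
    {ψ : v.adicCompletion F ≃+ v.adicCompletion F} (hψ : Realises v L (stripMulAut v φ) ψ) :
    ψ '' nonarchLogShell (v.adicCompletionIntegers F) L p ⊆ nonarchLogShell (v.adicCompletionIntegers F) L p := by
  rw [realises_stripMulAut_iff] at hψ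
  rintro _ ⟨a, ⟨u, rfl⟩, rfl⟩
  exact ⟨liftUnits v φ u, by rw [map_inv_natCast_mul, hψ u]⟩

/-- … and ONTO it (`(p^*)⁻¹ L u' = ψ((p^*)⁻¹ L ((liftUnits v φ)⁻¹ u'))`). [claim: Mochizuki2012, status: disputed] -/
theorem shell_subset_image_of_realises_strip (p : ℕ) {φ : Gal v ≃ₜ* Gal v}
    {ψ : v.adicCompletion F ≃+ v.adicCompletion F} (hψ : Realises v L (stripMulAut v φ) ψ) :
    nonarchLogShell (v.adicCompletionIntegers F) L p ⊆ ψ '' nonarchLogShell (v.adicCompletionIntegers F) L p := by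
  rw [realises_stripMulAut_iff] at hψ
  rintro a ⟨u', rfl⟩
  refine ⟨((pStar p : ℕ) : v.adicCompletion F)⁻¹ * L (Additive.ofMul ((liftUnits v φ).symm u')), ⟨_, rfl⟩, ?_⟩
  rw [map_inv_natCast_mul, hψ, MulEquiv.apply_symm_apply]

/-- **A realised strip automorphism maps the log-shell onto itself: `ψ(I_v) = I_v`.** [claim: Mochizuki2012, status: disputed] -/
theorem image_shell_eq_of_realises_strip (p : ℕ) {φ : Gal v ≃ₜ* Gal v}
    {ψ : v.adicCompletion F ≃+ v.adicCompletion F} (hψ : Realises v L (stripMulAut v φ) ψ) :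
    ψ '' nonarchLogShell (v.adicCompletionIntegers F) L p = nonarchLogShell (v.adicCompletionIntegers F) L p :=
  Set.Subset.antisymm (image_shell_subset_of_realises_strip v L p hψ) (shell_subset_image_of_realises_strip v L p hψ)

/-- **Every element of print's (Ind1) strip part maps the log-shell onto itself** — so, at a finite place, print's (Ind1)
strip automorphisms (like print's (Ind2), `image_shell_eq_of_mem_ismIsmOf`) ACT THROUGH Dupuy–Hilado's
`Aut_{ℚ_p}(K_v : I_v)`. [cite: DupuyHilado2025, §4.9] [claim: Mochizuki2012, status: disputed] -/
theorem image_shell_eq_of_mem_ind1StripOf (p : ℕ) {ψ : v.adicCompletion F ≃+ v.adicCompletion F}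
    (hψ : ψ ∈ ind1StripOf v L) :
    ψ '' nonarchLogShell (v.adicCompletionIntegers F) L p = nonarchLogShell (v.adicCompletionIntegers F) L p := by
  obtain ⟨-, -, φ, hr⟩ := hψ
  exact image_shell_eq_of_realises_strip v L p hr

/-- A realised strip automorphism maps the log-lattice `Λ_v := L(𝒪_v^×)` onto itself. [claim: Mochizuki2012, status: disputed] -/
theorem image_range_eq_of_realises_strip {φ : Gal v ≃ₜ* Gal v}
    {ψ : v.adicCompletion F ≃+ v.adicCompletion F} (hψ : Realises v L (stripMulAut v φ) ψ) :
    ψ '' Set.range L = Set.range L := by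
  rw [realises_stripMulAut_iff] at hψ
  apply Set.Subset.antisymm
  · rintro _ ⟨_, ⟨x, rfl⟩, rfl⟩
    refine ⟨Additive.ofMul (liftUnits v φ (Additive.toMul x)), ?_⟩
    rw [← hψ]; rfl
  · rintro _ ⟨x, rfl⟩
    refine ⟨L (Additive.ofMul ((liftUnits v φ).symm (Additive.toMul x))), ⟨_, rfl⟩, ?_⟩
    rw [hψ, MulEquiv.apply_symm_apply]; rfl

end Realisation

/-! ## 4. Inner automorphisms of `G_v` act trivially: the action factors through `Out(G_v)` -/

section Inner

/-- abc-iut-L4-t2's model `TM`-pair `(G_v ↷ 𝒪^⊳_{K̄_v})` at `v` (the pair THE lift lives on).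
[cite: MochizukiAbsTopIII2015, Definition 3.1 (ii) p.67] -/
abbrev modelPair : GaloisMonoidPair.{0} := (ModelMLFGaloisData.galois (closureAt v).k (closureAt v).K).tmPair

/-- The inner automorphism `conj(σ) : τ ↦ σ τ σ⁻¹` of `G_v`, as a topological automorphism. [folklore] -/
def innerAut (σ : Gal v) : Gal v ≃ₜ* Gal v :=
  { (MulAut.conj σ : MulAut (Gal v)) with
    continuous_toFun := (continuous_const.mul continuous_id).mul continuous_const
    continuous_invFun := (continuous_const.mul continuous_id).mul continuous_const }

/-- `innerAut v σ τ = σ * τ * σ⁻¹`. [folklore] -/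
@[simp] theorem innerAut_apply (σ τ : Gal v) : innerAut v σ τ = σ * τ * σ⁻¹ := rfl

/-- **THE lift of `conj(σ)` is `σ` itself**: `x ↦ σ • x` is a `conj(σ)`-equivariant automorphism of `𝒪^⊳_{K̄_v}`
(`σ • (τ • x) = (στσ⁻¹) • (σ • x)`), hence THE lift (`Genuine.liftM_unique`). [cite: MochizukiAbsTopIII2015, Proposition 3.2 (iv) p.72] -/
theorem liftM_innerAut (σ : Gal v) :
    Genuine.liftM (closureAt v) (innerAut v σ) =
      MulDistribMulAction.toMulEquiv (G := (modelPair v).Pi) (modelPair v).M σ := by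
  symm
  refine Genuine.liftM_unique (closureAt v) (innerAut v σ) _ fun (τ : Gal v) x => ?_
  apply Subtype.ext
  change σ (τ ((x : nonzeroIntegers (v.adicCompletion F) (AlgebraicClosure (v.adicCompletion F))) :
      AlgebraicClosure (v.adicCompletion F))) =
    (σ * τ * σ⁻¹) (σ ((x : nonzeroIntegers (v.adicCompletion F) (AlgebraicClosure (v.adicCompletion F))) :
      AlgebraicClosure (v.adicCompletion F)))
  rw [AlgEquiv.mul_apply, AlgEquiv.mul_apply, AlgEquiv.aut_inv, AlgEquiv.symm_apply_apply]

/-- Underlying element: `stripLift v (conj σ) x = σ(x)` in `K̄_v`. [cite: MochizukiAbsTopIII2015, Proposition 3.2 (iv) p.72] -/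
theorem coe_stripLift_innerAut (σ : Gal v) (x : OUnits v) :
    (((stripLift v (innerAut v σ) x : OUnits v) :
        nonzeroIntegers (v.adicCompletion F) (AlgebraicClosure (v.adicCompletion F))) :
      AlgebraicClosure (v.adicCompletion F)) =
      σ (((x : nonzeroIntegers (v.adicCompletion F) (AlgebraicClosure (v.adicCompletion F))) :
        AlgebraicClosure (v.adicCompletion F))) := by
  rw [coe_stripLift, liftM_innerAut, MulDistribMulAction.toMulEquiv_apply]
  exact Genuine.coe_smul_eq (closureAt v) _ _

/-- **THE lift of an inner automorphism IS the Galois action**: `stripLift v (conj σ) = galRho v σ` on `O^×(G_v)`.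
[cite: MochizukiAbsTopIII2015, Proposition 3.2 (iv) p.72] -/
theorem stripLift_innerAut (σ : Gal v) (x : OUnits v) : stripLift v (innerAut v σ) x = galRho v σ x := by
  apply Units.ext; apply Subtype.ext
  rw [coe_stripLift_innerAut, coe_galRho]

/-- **Inner automorphisms act trivially on `𝒪_v^×`**: `liftUnits v (conj σ) u = u` (`σ` fixes `K_v` pointwise).
[claim: Mochizuki2012, status: disputed] -/
theorem liftUnits_innerAut (σ : Gal v) (u : (↥(v.adicCompletionIntegers F))ˣ) : liftUnits v (innerAut v σ) u = u := by
  rw [liftUnits_apply, liftUnitsFun_eq_iff, stripLift_innerAut]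
  exact (mem_fixedBy _ _ _).mp (toOUnits_mem_fixedBy_top v u) σ (Subgroup.mem_top σ)

/-- On `O^{×μ}(G_v)`, the inner strip automorphism `conj(σ)` fixes the class of every `u ∈ 𝒪_v^×`.
[claim: Mochizuki2012, status: disputed] -/
theorem stripMulAut_innerAut_clsOf (σ : Gal v) (u : (↥(v.adicCompletionIntegers F))ˣ) :
    stripMulAut v (innerAut v σ) (clsOf v u) = clsOf v u := by
  rw [stripMulAut_clsOf, liftUnits_innerAut]

variable (L : Additive (↥(v.adicCompletionIntegers F))ˣ →+ v.adicCompletion F)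

/-- **A `ψ` realises an INNER automorphism of `G_v` iff it fixes the log-lattice `L(𝒪_v^×)` pointwise** — the
realised action of `Aut_top(G_v)` on `K_v` factors through `Out(G_v)`, as print's "isomorphisms of `†𝒟⊢_v`"
(equivalences `ℬ(G_v)⁰ ⥲ ℬ(G_v)⁰` up to isomorphism = outer isomorphisms of `G_v`) requires.
[claim: Mochizuki2012, status: disputed] -/
theorem realises_innerAut_iff (σ : Gal v) (ψ : v.adicCompletion F ≃+ v.adicCompletion F) :
    Realises v L (stripMulAut v (innerAut v σ)) ψ ↔
      ∀ u : (↥(v.adicCompletionIntegers F))ˣ, ψ (L (Additive.ofMul u)) = L (Additive.ofMul u) := by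
  rw [realises_stripMulAut_iff]
  refine forall_congr' fun u => ?_
  rw [liftUnits_innerAut]

/-- In particular the identity of `K_v` realises every inner automorphism. [claim: Mochizuki2012, status: disputed] -/
theorem realises_innerAut_refl (σ : Gal v) : Realises v L (stripMulAut v (innerAut v σ)) (AddEquiv.refl _) :=
  (realises_innerAut_iff v L σ _).mpr fun _ => rfl

end Inner

end Summit.ABC.IUTFork.Thm311.Real

end
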